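import Mathlib
import Literature.AlgebraicGeometry.Resolution.CobordantGame
import Literature.AlgebraicGeometry.Resolution.CobordantChartCoefficients
import Literature.AlgebraicGeometry.Resolution.FormalCoordinateChange
import Literature.RingTheory.MvPowerSeries.OptionEquivLeft
import Literature.RingTheory.HenselLemma.WeierstrassPreparation
import Literature.NumberTheory.GaloisRepresentations.NearlyOrdinaryPresentationProofs
import Summits.ResolutionOfSingularities.ResolutionOfSingularities.Theorems.WeightedInvariantGlobalizeLocalDropCanonize
import Summits.ResolutionOfSingularities.ResolutionOfSingularities.Theorems.WeightedInvariantLocalWeightedDropUnaryConeForm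

/-!
# `WeightedInvariant.LocalWeightedDrop`, line `hasse-ridge-face-selection`: the WEIERSTRASS (monic) form of a germ with
# unary tangent cone (wild multiplicities included)

Crux item stmt-ResolutionOfSingularities-8899 `LocalWeightedDrop` (route `ResolutionOfSingularities/WeightedInvariant`),
serving the door `WeightedConstruction` stmt-ResolutionOfSingularities-0571.  [OURS · L1 W4.3, chain w43, stub worker 3:
upgrade of helper N1 (`UnaryConeForm.exists_normalForm`, pseudo-Weierstrass) to a genuine Weierstrass form, and the
position space for D1 (the wild coefficient game) of CRUX-PLAN w43 §3C.  Not a statement of any manuscript.]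

MAIN RESULT (`exists_monicForm`; `k` infinite, any number `m + 1` of variables, any `d`): if `ord f ≥ d` and the degree-`d`
form of `f` is `λ · ℓ^d` as a function (`ℓ ≠ 0`, `λ ≠ 0`), then after an invertible LINEAR change `x ↦ M x`
```
  f ∘ M = H · (y^d + Σ_{j<d} A_j(x') · y^j),   H(0) ≠ 0,   A_j ∈ k[[x']],   ord A_j > d - j,
```
`y = X (Fin.last m)`.  Since `Won (H · P) ↔ Won P` and `Won (f ∘ M) ↔ Won f`, the winning problem for germs with unary tangent
cone is the winning problem for MONIC polynomials in `y` with `y`-free coefficients and the polyhedron `Δ(P; x'; y)` inside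
`{|u| > 1}` — a position space stable under the re-centrings `y ↦ y + φ(x')` (no maximal contact needed).  At `d = 2`:
`monicForm_two` and the game-level interface `normalFormsWon_of_monicFormsWon` (with N2,
`charTwoDoublePointSurfaceWon_of_normalForms`: CORE W″ piece S2 ⇐ «every monic `y² + A₁ y + A₀`, `ord A₁ ≥ 2`,
`ord A₀ ≥ 3`, over `k = k̄` of characteristic `2` is won given the germs in `≤ 2` variables»).

Steps.
* `exists_splitEquiv`: a ring isomorphism `k[[x', y]] ≃ k[[x']][[T]]` with `[x'^β]([T^n] e F) = [x'^β y^n] F`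
  (`MvPowerSeries.renameEquiv` along `finSuccEquiv' (Fin.last m)`, then the tree's `optionEquivLeft`).
* `isAdicComplete_maximalIdeal`: `k[[x']]` is complete (tree:
  `NearlyOrdinaryPresentationCA.isAdicComplete_maximalIdeal_mvPowerSeries`, the field being trivially complete).
* `exists_weierstrass`: Mathlib's Weierstrass division packaged by the tree's preparation theorem at an ideal
  (`Literature.RingTheory.HenselLemma.isWeierstrassDivisorAt_of_coeff_mem`, `exists_isWeierstrassFactorizationAt`) applied
  to `e F` over `A = k[[x']]`, `I = 𝔪_A`: the slices `[y^n] F`, `n < d`, lie in `𝔪_A` and `[y^d] F` is a unit; transported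
  back (`coeff_monicForm`: `e (y^d + Σ A_j y^j)` is the distinguished polynomial).
* `polyhedronCond_mul`: the condition «every monomial of `y`-degree `< d` has total degree `> d`» is stable under
  multiplication by any series, so it passes from `F = H · P` to `P = H⁻¹ F` (`exists_monic_of_polyhedronCond`,
  `order_lt_of_polyhedronCond_monicForm`); the pseudo-Weierstrass form satisfies it (`polyhedronCond_normalForm`).

References (method): Weierstrass preparation [Bourbaki, Alg. comm. VII §3 no. 8]; its use to write a hypersurface
singularity of multiplicity `d` as a monic polynomial of degree `d` in a transversal variable before reading Hironaka's
characteristic polyhedron [Cossart–Jannsen–Saito LNM 2270, Ch. 7–8; Cossart–Schober arXiv:1411.4452 §2]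
[corpus:paper:arxiv-1411.4452].
-/

set_option linter.dupNamespace false -- mandated namespace of this single-conjunct summit

namespace Summit.ResolutionOfSingularities.ResolutionOfSingularities.Theorems

open Literature.AlgebraicGeometry.Resolution

namespace WeierstrassForm

open MvPowerSeries

variable {k : Type} [Field k] {m : ℕ}

/-! ### The splitting `k[[x', y]] ≃ k[[x']][[y]]` and its coefficient formula -/

/-- There is a ring isomorphism `k[[x_0, …, x_m]] ≃ k[[x_0, …, x_{m-1}]][[T]]` sending the monomial `x'^β y^n`
(`y = X (Fin.last m)`) to `x'^β T^n`: `[x'^β]([T^n] e F) = [x'^β y^n] F` (rename along `Fin (m+1) ≃ Option (Fin m)`,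
`Fin.last m ↦ none`, then the tree's `optionEquivLeft`). -/
theorem exists_splitEquiv (k : Type) [Field k] (m : ℕ) :
    ∃ e : MvPowerSeries (Fin (m + 1)) k ≃+* PowerSeries (MvPowerSeries (Fin m) k),
      ∀ (F : MvPowerSeries (Fin (m + 1)) k) (n : ℕ) (β : Fin m →₀ ℕ),
        coeff β (PowerSeries.coeff n (e F)) =
          coeff (Finsupp.embDomain (Fin.succAboveEmb (Fin.last m)) β + Finsupp.single (Fin.last m) n) F := by
  classical
  refine ⟨(MvPowerSeries.renameEquiv k (finSuccEquiv' (Fin.last m))).toRingEquiv.trans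
    Literature.RingTheory.MvPowerSeries.optionEquivLeft, fun F n β => ?_⟩
  have happ : ((MvPowerSeries.renameEquiv k (finSuccEquiv' (Fin.last m))).toRingEquiv.trans
      Literature.RingTheory.MvPowerSeries.optionEquivLeft) F =
      Literature.RingTheory.MvPowerSeries.optionEquivLeft
        (rename (finSuccEquiv' (Fin.last m)).toEmbedding F) := rfl
  have hx : Finsupp.embDomain (finSuccEquiv' (Fin.last m)).toEmbedding
      (Finsupp.embDomain (Fin.succAboveEmb (Fin.last m)) β + Finsupp.single (Fin.last m) n) = β.optionElim n := by
    ext o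
    obtain ⟨i, rfl⟩ : ∃ i, o = (finSuccEquiv' (Fin.last m)).toEmbedding i :=
      ⟨(finSuccEquiv' (Fin.last m)).symm o, by simp⟩
    rw [Finsupp.embDomain_apply_self]
    rcases Fin.eq_castSucc_or_eq_last i with ⟨j, rfl⟩ | rfl
    · rw [TschirnhausForm.emb_add_single_castSucc, Equiv.toEmbedding_apply, ← Fin.succAbove_last_apply,
        finSuccEquiv'_succAbove]
      simp
    · rw [TschirnhausForm.emb_add_single_last, Equiv.toEmbedding_apply, finSuccEquiv'_at]
      simp
  rw [happ, Literature.RingTheory.MvPowerSeries.coeff_coeff_optionEquivLeft, ← hx, coeff_embDomain_rename]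

/-! ### `k[[x']]` is complete for its maximal ideal; membership in the maximal ideal -/

/-- `k[[x_0, …, x_{m-1}]]` is adically complete for its maximal ideal. -/
theorem isAdicComplete_maximalIdeal (k : Type) [Field k] (m : ℕ) :
    IsAdicComplete (IsLocalRing.maximalIdeal (MvPowerSeries (Fin m) k)) (MvPowerSeries (Fin m) k) := by
  have : IsAdicComplete (IsLocalRing.maximalIdeal k) k := by
    rw [IsLocalRing.maximalIdeal_eq_bot]
    infer_instance
  exact Literature.NumberTheory.GaloisRepresentations.NearlyOrdinaryPresentationCA.isAdicComplete_maximalIdeal_mvPowerSeries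
    k m

/-- A series over a field lies in the maximal ideal of `k[[x']]` iff its constant coefficient vanishes. -/
theorem mem_maximalIdeal_iff {σ : Type} (a : MvPowerSeries σ k) :
    a ∈ IsLocalRing.maximalIdeal (MvPowerSeries σ k) ↔ constantCoeff a = 0 := by
  rw [IsLocalRing.mem_maximalIdeal, mem_nonunits_iff, isUnit_iff_constantCoeff, isUnit_iff_ne_zero, not_not]

/-! ### Coefficients of a monic form `y^d + Σ_{j<d} A_j(x') y^j` -/

/-- COEFFICIENTS OF A MONIC FORM at `x'^β y^n`: `[β = 0]` for `n = d`, `[x'^β] A_n` for `n < d`, `0` for `n > d`. -/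
theorem coeff_monicForm {d : ℕ} (A : Fin d → MvPowerSeries (Fin m) k) (β : Fin m →₀ ℕ) (n : ℕ) :
    coeff (Finsupp.embDomain (Fin.succAboveEmb (Fin.last m)) β + Finsupp.single (Fin.last m) n)
        (X (Fin.last m) ^ d + ∑ j : Fin d, rename (Fin.succAboveEmb (Fin.last m)) (A j) * X (Fin.last m) ^ (j : ℕ)) =
      (if n = d then coeff β (1 : MvPowerSeries (Fin m) k) else 0) +
        ∑ j : Fin d, if (j : ℕ) = n then coeff β (A j) else 0 := by
  classical
  rw [map_add, map_sum]
  congr 1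
  · rw [← one_mul (X (Fin.last m) ^ d), TschirnhausForm.coeff_emb_add_single_mul_X_pow,
      ← map_one (rename (Fin.succAboveEmb (Fin.last m))), TschirnhausForm.coeff_emb_add_single_rename]
    by_cases h : n = d
    · rw [if_pos h.symm.le, h, Nat.sub_self, if_pos rfl, if_pos rfl]
    · rw [if_neg h]
      split_ifs with h1 h2
      · exact absurd h2 (by omega)
      · rfl
      · rfl
  · refine Finset.sum_congr rfl fun j _ => ?_
    rw [TschirnhausForm.coeff_emb_add_single_mul_X_pow]
    by_cases hj : (j : ℕ) = n
    · rw [if_pos hj.le, if_pos hj, TschirnhausForm.coeff_emb_add_single_rename, if_pos (by omega)]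
    · rw [if_neg hj]
      split_ifs with hle
      · rw [TschirnhausForm.coeff_emb_add_single_rename, if_neg (by omega)]
      · rfl

/-- The `y^n`-slice of a monic form for `n < d` is `A_n`. -/
theorem coeff_monicForm_of_lt {d : ℕ} (A : Fin d → MvPowerSeries (Fin m) k) (β : Fin m →₀ ℕ) (j : Fin d) :
    coeff (Finsupp.embDomain (Fin.succAboveEmb (Fin.last m)) β + Finsupp.single (Fin.last m) (j : ℕ))
        (X (Fin.last m) ^ d + ∑ l : Fin d, rename (Fin.succAboveEmb (Fin.last m)) (A l) * X (Fin.last m) ^ (l : ℕ)) =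
      coeff β (A j) := by
  rw [coeff_monicForm, if_neg (ne_of_lt j.2), zero_add, Finset.sum_eq_single j]
  · rw [if_pos rfl]
  · intro l _ hl
    rw [if_neg (fun h => hl (Fin.ext h))]
  · intro h
    exact absurd (Finset.mem_univ j) h

/-! ### The polyhedron condition «every monomial of `y`-degree `< d` has total degree `> d`» -/

/-- The condition «every monomial `x'^α y^j` of `F` with `j < d` has `|α| + j > d`» (the polyhedron
`Δ(F; x'; y)` lies in `{|u| > 1}`) is stable under multiplication by ANY series. -/
theorem polyhedronCond_mul {d : ℕ} {F : MvPowerSeries (Fin (m + 1)) k}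
    (hF : ∀ E : Fin (m + 1) →₀ ℕ, E (Fin.last m) < d → E.degree ≤ d → coeff E F = 0)
    (V : MvPowerSeries (Fin (m + 1)) k) :
    ∀ E : Fin (m + 1) →₀ ℕ, E (Fin.last m) < d → E.degree ≤ d → coeff E (V * F) = 0 := by
  classical
  intro E hEy hEd
  rw [coeff_mul]
  refine Finset.sum_eq_zero fun q hq => ?_
  rw [Finset.HasAntidiagonal.mem_antidiagonal] at hq
  have h2y : q.2 (Fin.last m) ≤ E (Fin.last m) := by rw [← hq, Finsupp.add_apply]; omega
  have h2d : q.2.degree ≤ E.degree := by rw [← hq, map_add]; omega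
  rw [hF q.2 (lt_of_le_of_lt h2y hEy) (le_trans h2d hEd), mul_zero]

/-- The pseudo-Weierstrass normal form `U y^d + Σ_{j<d} a_j y^j` with `ord a_j > d - j` satisfies the polyhedron
condition. -/
theorem polyhedronCond_normalForm {d : ℕ} (U : MvPowerSeries (Fin (m + 1)) k) (a : Fin d → MvPowerSeries (Fin m) k)
    (ha : ∀ j : Fin d, ((d - (j : ℕ) : ℕ) : ℕ∞) < (a j).order) :
    ∀ E : Fin (m + 1) →₀ ℕ, E (Fin.last m) < d → E.degree ≤ d →
      coeff E (U * X (Fin.last m) ^ d +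
        ∑ j : Fin d, rename (Fin.succAboveEmb (Fin.last m)) (a j) * X (Fin.last m) ^ (j : ℕ)) = 0 := by
  classical
  intro E hEy hEd
  obtain ⟨β, hE⟩ := TschirnhausForm.exists_eq_emb_add_single E
  set n := E (Fin.last m) with hn
  have hdeg : E.degree = β.degree + n := by rw [hE, TschirnhausForm.degree_emb_add_single]
  rw [hE, map_add, TschirnhausForm.coeff_emb_add_single_mul_X_pow, if_neg (by omega), zero_add, map_sum]
  refine Finset.sum_eq_zero fun j _ => ?_
  rw [TschirnhausForm.coeff_emb_add_single_mul_X_pow]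
  split_ifs with hle
  · rw [TschirnhausForm.coeff_emb_add_single_rename]
    split_ifs with h0
    · apply coeff_of_lt_order
      refine lt_of_le_of_lt ?_ (ha j)
      exact_mod_cast (by omega : β.degree ≤ d - (j : ℕ))
    · rfl
  · rfl

/-- From the polyhedron condition for a monic form: `ord A_j > d - j`. -/
theorem order_lt_of_polyhedronCond_monicForm {d : ℕ} (A : Fin d → MvPowerSeries (Fin m) k)
    (hP : ∀ E : Fin (m + 1) →₀ ℕ, E (Fin.last m) < d → E.degree ≤ d →
      coeff E (X (Fin.last m) ^ d +
        ∑ j : Fin d, rename (Fin.succAboveEmb (Fin.last m)) (A j) * X (Fin.last m) ^ (j : ℕ)) = 0)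
    (j : Fin d) : ((d - (j : ℕ) : ℕ) : ℕ∞) < (A j).order := by
  refine lt_of_lt_of_le (ENat.coe_lt_coe.mpr (Nat.lt_succ_self _)) (nat_le_order fun β hβ => ?_)
  rw [← coeff_monicForm_of_lt A β j]
  refine hP _ ?_ ?_
  · rw [TschirnhausForm.emb_add_single_last]
    exact j.2
  · rw [TschirnhausForm.degree_emb_add_single]
    have := j.2
    omega


/-! ### The coefficient of `y^d` in a pseudo-Weierstrass normal form -/

/-- In `U y^d + Σ_{j<d} a_j(x') y^j` the coefficient of `y^d` is `U(0)`. -/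
theorem coeff_single_normalForm {d : ℕ} (U : MvPowerSeries (Fin (m + 1)) k) (a : Fin d → MvPowerSeries (Fin m) k) :
    coeff (Finsupp.single (Fin.last m) d) (U * X (Fin.last m) ^ d +
        ∑ j : Fin d, rename (Fin.succAboveEmb (Fin.last m)) (a j) * X (Fin.last m) ^ (j : ℕ)) = constantCoeff U := by
  classical
  have h0 : Finsupp.single (Fin.last m) d =
      Finsupp.embDomain (Fin.succAboveEmb (Fin.last m)) (0 : Fin m →₀ ℕ) + Finsupp.single (Fin.last m) d := by
    rw [Finsupp.embDomain_zero, zero_add]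
  rw [h0, map_add, map_sum, TschirnhausForm.coeff_emb_add_single_mul_X_pow, if_pos le_rfl, Nat.sub_self,
    Finset.sum_eq_zero, add_zero, Finsupp.single_zero, add_zero, Finsupp.embDomain_zero,
    coeff_zero_eq_constantCoeff_apply]
  intro j _
  rw [TschirnhausForm.coeff_emb_add_single_mul_X_pow, if_pos (le_of_lt j.2), TschirnhausForm.coeff_emb_add_single_rename,
    if_neg (by have := j.2; omega)]

/-! ### Weierstrass preparation in `k[[x']][[y]]` -/

/-- WEIERSTRASS PREPARATION, transported to `k[[x', y]]`: if the `y^n`-slices of `F` have zero constant term for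
`n < d` and the `y^d`-coefficient of `F` is non-zero, then `F = H · (y^d + Σ_{j<d} A_j(x') y^j)` with `H(0) ≠ 0` and
`A_j(0) = 0` (Mathlib's Weierstrass division + the tree's preparation theorem at an ideal of an adically complete ring,
`Literature.RingTheory.HenselLemma.exists_isWeierstrassFactorizationAt`, over `A = k[[x']]`, complete for its maximal
ideal). -/
theorem exists_weierstrass {d : ℕ} (F : MvPowerSeries (Fin (m + 1)) k)
    (hlow : ∀ n < d, coeff (Finsupp.single (Fin.last m) n) F = 0)
    (htop : coeff (Finsupp.single (Fin.last m) d) F ≠ 0) :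
    ∃ (H : MvPowerSeries (Fin (m + 1)) k) (A : Fin d → MvPowerSeries (Fin m) k),
      constantCoeff H ≠ 0 ∧ (∀ j, constantCoeff (A j) = 0) ∧
      F = H * (X (Fin.last m) ^ d + ∑ j : Fin d, rename (Fin.succAboveEmb (Fin.last m)) (A j) * X (Fin.last m) ^ (j : ℕ)) := by
  classical
  obtain ⟨e, he⟩ := exists_splitEquiv k m
  haveI := isAdicComplete_maximalIdeal k m
  have hItop : IsLocalRing.maximalIdeal (MvPowerSeries (Fin m) k) ≠ ⊤ :=
    (IsLocalRing.maximalIdeal.isMaximal (MvPowerSeries (Fin m) k)).ne_top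
  have hcoeff0 : ∀ n, constantCoeff (PowerSeries.coeff n (e F)) = coeff (Finsupp.single (Fin.last m) n) F := by
    intro n
    rw [← coeff_zero_eq_constantCoeff_apply, he, Finsupp.embDomain_zero, zero_add]
  have hmem : ∀ i < d, PowerSeries.coeff i (e F) ∈ IsLocalRing.maximalIdeal (MvPowerSeries (Fin m) k) :=
    fun i hi => by rw [mem_maximalIdeal_iff, hcoeff0, hlow i hi]
  have hunit : IsUnit (PowerSeries.coeff d (e F)) := by
    rw [isUnit_iff_constantCoeff, hcoeff0, isUnit_iff_ne_zero]
    exact htop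
  obtain ⟨hdiv, hord⟩ := Literature.RingTheory.HenselLemma.isWeierstrassDivisorAt_of_coeff_mem hmem hunit hItop
  obtain ⟨f, h, hfac, hdeg⟩ := Literature.RingTheory.HenselLemma.exists_isWeierstrassFactorizationAt hdiv hItop
  rw [hord] at hdeg
  set P : MvPowerSeries (Fin (m + 1)) k := X (Fin.last m) ^ d +
    ∑ j : Fin d, rename (Fin.succAboveEmb (Fin.last m)) (f.coeff (j : ℕ)) * X (Fin.last m) ^ (j : ℕ) with hP
  -- `e P` is the distinguished polynomial `f`
  have heP : e P = (f : PowerSeries (MvPowerSeries (Fin m) k)) := by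
    ext n β
    rw [he, hP, coeff_monicForm, Polynomial.coeff_coe]
    by_cases hnd : n = d
    · rw [if_pos hnd, Finset.sum_eq_zero (fun j _ => if_neg (by have := j.2; omega)), add_zero, hnd, ← hdeg,
        hfac.isDistinguishedAt.monic.coeff_natDegree]
    · rw [if_neg hnd, zero_add]
      rcases Nat.lt_or_gt_of_ne hnd with hlt | hgt
      · rw [Finset.sum_eq_single (⟨n, hlt⟩ : Fin d)]
        · rw [if_pos rfl]
        · intro j _ hj
          exact if_neg (fun h => hj (Fin.ext h))
        · intro h
          exact absurd (Finset.mem_univ _) h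
      · rw [Finset.sum_eq_zero (fun j _ => if_neg (by have := j.2; omega)),
          Polynomial.coeff_eq_zero_of_natDegree_lt (by rw [hdeg]; exact hgt), map_zero]
  refine ⟨e.symm h, fun j => f.coeff (j : ℕ), ?_, ?_, ?_⟩
  · have hu : IsUnit (e.symm h) := hfac.isUnit.map e.symm
    rw [isUnit_iff_constantCoeff, isUnit_iff_ne_zero] at hu
    exact hu
  · intro j
    have hj : (j : ℕ) < f.natDegree := by rw [hdeg]; exact j.2
    exact (mem_maximalIdeal_iff _).mp (hfac.isDistinguishedAt.mem hj)
  · calc F = e.symm (e F) := (RingEquiv.symm_apply_apply e F).symm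
      _ = e.symm h * e.symm (e P) := by rw [hfac.eq_mul, map_mul, heP, mul_comm]
      _ = e.symm h * P := by rw [RingEquiv.symm_apply_apply]

/-- MONIC FORM FROM THE POLYHEDRON CONDITION.  If every monomial of `F` of `y`-degree `< d` has total degree `> d`
and the `y^d`-coefficient of `F` is non-zero, then `F = H · (y^d + Σ_{j<d} A_j(x') y^j)` with `H(0) ≠ 0` and
`ord A_j > d - j` (the polyhedron condition passes to `H⁻¹ F`). -/
theorem exists_monic_of_polyhedronCond {d : ℕ} (F : MvPowerSeries (Fin (m + 1)) k)
    (hPF : ∀ E : Fin (m + 1) →₀ ℕ, E (Fin.last m) < d → E.degree ≤ d → coeff E F = 0)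
    (htop : coeff (Finsupp.single (Fin.last m) d) F ≠ 0) :
    ∃ (H : MvPowerSeries (Fin (m + 1)) k) (A : Fin d → MvPowerSeries (Fin m) k),
      constantCoeff H ≠ 0 ∧ (∀ j : Fin d, ((d - (j : ℕ) : ℕ) : ℕ∞) < (A j).order) ∧
      F = H * (X (Fin.last m) ^ d + ∑ j : Fin d, rename (Fin.succAboveEmb (Fin.last m)) (A j) * X (Fin.last m) ^ (j : ℕ)) := by
  have hlow : ∀ n < d, coeff (Finsupp.single (Fin.last m) n) F = 0 := fun n hn =>
    hPF _ (by rw [Finsupp.single_eq_same]; exact hn) (by rw [Finsupp.degree_single]; exact hn.le)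
  obtain ⟨H, A, hH, -, hFeq⟩ := exists_weierstrass F hlow htop
  refine ⟨H, A, hH, fun j => order_lt_of_polyhedronCond_monicForm A ?_ j, hFeq⟩
  have hPinv := polyhedronCond_mul hPF H⁻¹
  rw [hFeq, ← mul_assoc, MvPowerSeries.inv_mul_cancel _ hH, one_mul] at hPinv
  exact hPinv

/-! ### The monic form of a germ with unary tangent cone -/

/-- THE WEIERSTRASS (MONIC) FORM OF A GERM WITH UNARY TANGENT CONE (every multiplicity, wild ones included; `k`
infinite).  If `ord f ≥ d` and the degree-`d` form of `f` is `λ · ℓ^d` as a function with `ℓ ≠ 0`, `λ ≠ 0`, then after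
the invertible linear change `x ↦ M x`:  `f ∘ M = H · (y^d + Σ_{j<d} A_j(x') · y^j)` with `H(0) ≠ 0`, `A_j ∈ k[[x']]`
and `ord A_j > d - j` (`y = X (Fin.last m)`).  In the game, `f` is won iff the MONIC germ `y^d + Σ A_j y^j` is
(`won_subst_iff`, `won_unit_mul_iff`), and monic germs with `y`-free coefficients are stable under the re-centrings
`y ↦ y + φ(x')` — the position space of the wild coefficient game. -/
theorem exists_monicForm [Infinite k] (f : MvPowerSeries (Fin (m + 1)) k) (d : ℕ) (hfo : (d : ℕ∞) ≤ f.order)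
    (ℓ : Fin (m + 1) → k) (hℓ : ℓ ≠ 0) (la : k) (hla : la ≠ 0)
    (hcone : ∀ v : Fin (m + 1) → k,
      CobordantChart.initEval (fun _ : Fin (m + 1) => 1) v d f = la * dotProduct ℓ v ^ d) :
    ∃ (M : Matrix (Fin (m + 1)) (Fin (m + 1)) k) (H : MvPowerSeries (Fin (m + 1)) k)
      (A : Fin d → MvPowerSeries (Fin m) k),
      IsUnit M.det ∧ constantCoeff H ≠ 0 ∧
      (∀ j : Fin d, ((d - (j : ℕ) : ℕ) : ℕ∞) < (A j).order) ∧
      subst (FormalCoordChange.linSubst M) f = H * (X (Fin.last m) ^ d +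
        ∑ j : Fin d, rename (Fin.succAboveEmb (Fin.last m)) (A j) * X (Fin.last m) ^ (j : ℕ)) := by
  obtain ⟨M, U, a, hMdet, hU, ha, hfeq⟩ := UnaryConeForm.exists_normalForm f d hfo ℓ hℓ la hcone
  have hPF := polyhedronCond_normalForm U a ha
  have htop : coeff (Finsupp.single (Fin.last m) d) (U * X (Fin.last m) ^ d +
      ∑ j : Fin d, rename (Fin.succAboveEmb (Fin.last m)) (a j) * X (Fin.last m) ^ (j : ℕ)) ≠ 0 := by
    rw [coeff_single_normalForm, hU]
    exact hla
  obtain ⟨H, A, hH, hA, hFeq⟩ := exists_monic_of_polyhedronCond _ hPF htop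
  exact ⟨M, H, A, hMdet, hH, hA, by rw [hfeq, hFeq]⟩

/-- THE MONIC FORM AT `d = 2` in the spelling of `UnaryConeForm.normalForm_of_sq` / CORE W″ piece S2: a pseudo-Weierstrass
normal form `U y² + a₁ y + a₀` (`U(0) ≠ 0`, `ord a₁ ≥ 2`, `ord a₀ ≥ 3`) is `H · (y² + A₁ y + A₀)` with `H(0) ≠ 0`,
`ord A₁ ≥ 2`, `ord A₀ ≥ 3`, `A₀, A₁ ∈ k[[x']]`. -/
theorem monicForm_two {U : MvPowerSeries (Fin (m + 1)) k} (hU : constantCoeff U ≠ 0) (a₀ a₁ : MvPowerSeries (Fin m) k)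
    (ha₀ : (2 : ℕ∞) < a₀.order) (ha₁ : (1 : ℕ∞) < a₁.order) :
    ∃ (H : MvPowerSeries (Fin (m + 1)) k) (A₀ A₁ : MvPowerSeries (Fin m) k),
      constantCoeff H ≠ 0 ∧ (2 : ℕ∞) < A₀.order ∧ (1 : ℕ∞) < A₁.order ∧
      U * X (Fin.last m) ^ 2 +
          (rename (Fin.succAboveEmb (Fin.last m)) a₀ + rename (Fin.succAboveEmb (Fin.last m)) a₁ * X (Fin.last m)) =
        H * (X (Fin.last m) ^ 2 +
          (rename (Fin.succAboveEmb (Fin.last m)) A₀ + rename (Fin.succAboveEmb (Fin.last m)) A₁ * X (Fin.last m))) := by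
  have hshape : ∀ b₀ b₁ : MvPowerSeries (Fin m) k,
      rename (Fin.succAboveEmb (Fin.last m)) b₀ + rename (Fin.succAboveEmb (Fin.last m)) b₁ * X (Fin.last m) =
        ∑ j : Fin 2, rename (Fin.succAboveEmb (Fin.last m)) ((![b₀, b₁] : Fin 2 → MvPowerSeries (Fin m) k) j) *
          X (Fin.last m) ^ (j : ℕ) := by
    intro b₀ b₁
    rw [Fin.sum_univ_two]
    simp
  have ha : ∀ j : Fin 2, ((2 - (j : ℕ) : ℕ) : ℕ∞) < ((![a₀, a₁] : Fin 2 → MvPowerSeries (Fin m) k) j).order := by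
    intro j
    fin_cases j
    · simpa using ha₀
    · simpa using ha₁
  have hPF := polyhedronCond_normalForm (d := 2) U (![a₀, a₁]) ha
  have htop : coeff (Finsupp.single (Fin.last m) 2) (U * X (Fin.last m) ^ 2 +
      ∑ j : Fin 2, rename (Fin.succAboveEmb (Fin.last m)) ((![a₀, a₁] : Fin 2 → MvPowerSeries (Fin m) k) j) *
        X (Fin.last m) ^ (j : ℕ)) ≠ 0 := by
    rw [coeff_single_normalForm]
    exact hU
  obtain ⟨H, A, hH, hA, hFeq⟩ := exists_monic_of_polyhedronCond _ hPF htop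
  refine ⟨H, A 0, A 1, hH, by simpa using hA 0, by simpa using hA 1, ?_⟩
  rw [hshape a₀ a₁, hFeq, hshape (A 0) (A 1)]
  congr 2


end WeierstrassForm

open WeierstrassForm Literature.AlgebraicGeometry.Resolution.CobordantGame in
/-- THE GAME-LEVEL INTERFACE AT `d = 2` (CORE W″ piece S2, after N2 `charTwoDoublePointSurfaceWon_of_normalForms`): if every
MONIC double point `y² + A₁(x') y + A₀(x')` with `ord A₁ ≥ 2`, `ord A₀ ≥ 3` is won, then every pseudo-Weierstrass normal
form `U y² + a₁ y + a₀` (`U(0) = 1`, `ord a₁ ≥ 2`, `ord a₀ ≥ 3`) is won (`monicForm_two` + `won_unit_mul_iff`); any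
dimension `m + 1`, any characteristic, the ambient hypotheses (here: the germs in fewer variables) passed through unchanged. -/
theorem normalFormsWon_of_monicFormsWon {k : Type} [Field k] {m : ℕ} {P : Prop}
    (hmonic : P → ∀ (A₀ A₁ : MvPowerSeries (Fin m) k), (2 : ℕ∞) < A₀.order → (1 : ℕ∞) < A₁.order →
      CobordantGame.Won k (m + 1) (MvPowerSeries.X (Fin.last m) ^ 2 +
        (MvPowerSeries.rename (Fin.succAboveEmb (Fin.last m)) A₀ +
          MvPowerSeries.rename (Fin.succAboveEmb (Fin.last m)) A₁ * MvPowerSeries.X (Fin.last m)))) :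
    P → ∀ (U : MvPowerSeries (Fin (m + 1)) k) (a₀ a₁ : MvPowerSeries (Fin m) k),
      MvPowerSeries.constantCoeff U = 1 → (2 : ℕ∞) < a₀.order → (1 : ℕ∞) < a₁.order →
      CobordantGame.Won k (m + 1) (U * MvPowerSeries.X (Fin.last m) ^ 2 +
        (MvPowerSeries.rename (Fin.succAboveEmb (Fin.last m)) a₀ +
          MvPowerSeries.rename (Fin.succAboveEmb (Fin.last m)) a₁ * MvPowerSeries.X (Fin.last m))) := by
  intro hP U a₀ a₁ hU ha₀ ha₁
  have hU0 : MvPowerSeries.constantCoeff U ≠ 0 := by rw [hU]; exact one_ne_zero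
  obtain ⟨H, A₀, A₁, hH, hA₀, hA₁, hFeq⟩ := monicForm_two hU0 a₀ a₁ ha₀ ha₁
  rw [hFeq]
  exact (won_unit_mul_iff hH _).mpr (hmonic hP A₀ A₁ hA₀ hA₁)


end Summit.ResolutionOfSingularities.ResolutionOfSingularities.Theorems
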